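import Summits.QuantumFields.BalabanUV.T4Continuum.Support.NE9Lemma1KernelSpecies
import Summits.QuantumFields.BalabanUV.T4Continuum.Support.NE9Lemma1RemainderSpeciesAdditive

/-!
# NE9Lemma1KernelSpeciesAdditive — S3 for the KERNEL species (the point-localized terms of [I] §4) on the ANALYTIC class: the
# piece-additivity binder `PieceAdditiveOn (analyticClass K.R) K.toC` of the row owner's kernel-species piece form
# (`NE9Lemma1KernelSpecies`, t4-ne9-p1-g25, p214555 — the byte-identical re-file of p214232) DISCHARGED from two DISPLAYED regularity binders of the bilocal summand —
# its additivity in the old term on the analytic class and its joint continuity in the contour variables — whence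
# `ChannelAdditive` and the four S-binders of the NE9 END for the kernel species' channel (cell `pub-balaban`, T4-DAG §2 node U3 /
# §6 NE9; rung (B)+1 on a FIXED finite T⁴; NE9 formalisation crew row **(w23)** of the owner's l.10121, unit
# `b2b-balaban-t4-ne9-formalise-leaf-01` gen 6, journal CLAIM l.10288; the (w16) / (w19) template of leaf-08-g4
# (`NE9Lemma1RemainderSpeciesAdditive` p213082) transposed to the kernel species; nothing of any import is modified)

HONEST FRAMING (T4-DAG PAGE 1).  Rung (B)+1 = existence and uniqueness of the ε → 0 limit of gauge-invariant observables on a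
FIXED finite torus T⁴ — NOT infinite volume, NOT a mass gap, NOT the Clay problem.  NE9 (`T4OutputRate.NE9` ∧ `FadingMemory`) is
a cell NEW ESTIMATE, NOT PRINTED and NOT discharged here («NE9 ⇐ the named binders»).  What is kernel here is FORM-LEVEL
PLUMBING for species (b): the kernel species' piece at the source (X, re/im) is the Re/Im part of the (1.23) contour functional
(t_□-circle of radius r_k, the iterated Cauchy operation `B13Sect1Arith.cauchyOp` over the cubes at σ-radius e^{κ₁}) of the DOUBLE
POINT SUM `K.dsum` of the bilocal summand `K.ker … p q F` read on the complex old term `F = lift H X`; this file proves that this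
piece is SUBTRACTIVE in `H` on the analytic class `analyticClass K.R` from two DISPLAYED binders on the datum's summand (TYPE [I]
(4.21) p. 285 / (4.22) p. 286: the point-localized kernels are MULTILINEAR in the derivatives of the old term, hence additive in it,
and depend continuously on the contour point): (A) `hkerA` — for `F₁, F₂` analytic on the ball of radius `R_X`, `ker … p q (F₁ − F₂)
= ker … p q F₁ − ker … p q F₂` (p, q in the point family); (C) `hkerC` — for `F` analytic on that ball, `(t, s′, σ′) ↦ ker … t s′ σ′ p
q F` is jointly continuous.  Nothing about Bałaban's actual (4.21)/(4.25)/(4.29)/(4.30) kernels (O-NE9-1), nor (K)/(G)/(S) of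
`KerData.Admissible`, is asserted; 0 `def`, 0 `sorry`; [I]/[II] locators are TYPE locators (ABSOLUTE RULE); `FlowStep.BetaPertH`,
(B), (B^μ) do not occur.  HONEST DEPENDENCY (verbatim): continuum YM on T⁴ ⇐ BetaPertH ∧ nine spine estimates (0/9 proved);
BetaPertH ⇐ (D1) ∧ (D4) ∧ CAP+tail; G-an2-4 gates asym, D1 and NE2/3/4.

WHAT IS PROVED (kernel).
§1 GENERIC (the common core of leaf-08-g4's `remPiece_sub` / `curPiece_sub`, stated once for any jointly continuous integrand
   family `G : ℂ → (ι → ℝ) → (ι → ℂ) → F`): `continuous_cauchyOp_param` (t ↦ cauchyOp ρ l (G t) s σ is continuous),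
   `circleIntegrable_contourIntegrand` (the t_□-integrand `(t²)⁻¹ • cauchyOp ρ l (G t) s σ` is circle-integrable on |t| = r > 0),
   **`contourOp_sub`**: the (1.23) contour functional `G ↦ (2πi)⁻¹ ∮_{|t|=r} t⁻² · cauchyOp ρ l (G t) s σ dt` is SUBTRACTIVE on
   jointly continuous families (`ρ > 1`, `r > 0`; `NE9RemainderPieceAdditive.cauchyOp_sub` + `circleIntegral.integral_sub`).
§2 THE KERNEL SPECIES: `toC_piece_eq` (the piece, definitionally), `dsum_sub` / `continuous_dsum` (finite double sums),
   **`pieceAdditiveOn_ker`**: `PieceAdditiveOn (analyticClass K.R) K.toC` under `0 < κ₁`, `0 < r_k`, (A), (C) — crew row (w23);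
   `channelAdditive_ker` (the owner's `channelAdditive_ker_of_pieceAdditive` fed), and **`sBinders_ker`**: all four S-binders
   (S3 `ChannelAdditive`, S4 `ChannelLocal` / `ChannelStepSum`, S5 `ChannelSizeAtStepNN` at the TWO-RATE weight — the owner's
   `structureBinders_ker` / `channelSizeAtStepNN_ker` BY NAME) for `cpieceChannel K.toC` on the analytic class, from
   `KerData.Admissible`, the level counts at the output rate `κ − w`, (A) and (C).
DISGUISE TEST: additivity / continuity plumbing about ONE input family; no two-history content; not NE9.

References (TYPE locators only; nothing printed is a hypothesis): T. Bałaban, CMP **109** (1987) [Balaban1987RG1] (4.3) p. 282,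
(4.15) p. 284, (4.17)–(4.21) p. 285, (4.22) p. 286, (4.24)–(4.30) pp. 287–288; CMP **116** (1988) [Balaban1988RG2Cluster] (1.10) p. 4,
(1.22)–(1.23) p. 7.
-/

noncomputable section

namespace Summit.QuantumFields.BalabanUV.T4Continuum.NE9Lemma1KernelSpeciesAdditive

open scoped BigOperators
open Metric Set Complex MeasureTheory
open Literature.MathematicalPhysics.QuantumFieldTheory.Balaban1983to89
open Literature.MathematicalPhysics.QuantumFieldTheory.Balaban1983to89.B13Sect1Arith (cauchyOp)
open Literature.MathematicalPhysics.QuantumFieldTheory.Balaban1983to89.T4OutputRate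
open Literature.MathematicalPhysics.QuantumFieldTheory.Balaban1983to89.T4HistoryLipschitzRecursion
open Summit.QuantumFields.BalabanUV.T4Continuum.NE9Lemma1Counting
open Summit.QuantumFields.BalabanUV.T4Continuum.NE9Lemma1Gain
open Summit.QuantumFields.BalabanUV.T4Continuum.NE9Lemma1PieceClass
open Summit.QuantumFields.BalabanUV.T4Continuum.NE9Lemma1PieceClassTwoRate
open Summit.QuantumFields.BalabanUV.T4Continuum.NE9Lemma1RemainderSpecies
open Summit.QuantumFields.BalabanUV.T4Continuum.NE9Lemma1KernelSpecies
open Summit.QuantumFields.BalabanUV.T4Continuum.NE9ComplexEncoding (doubleCarriers)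
open Summit.QuantumFields.BalabanUV.T4Continuum.NE9RemainderPieceAdditive (cauchyOp_sub continuous_cauchyOp)
open Summit.QuantumFields.BalabanUV.T4Continuum.NE9Lemma1RemainderSpeciesAdditive (reIm_sub one_lt_exp_of_pos)

/-! ## §1 The (1.23) contour functional is subtractive on jointly continuous integrand families -/

section Contour

variable {ι : Type*} [DecidableEq ι] {F : Type*} [NormedAddCommGroup F] [NormedSpace ℂ F]

/-- For a jointly continuous family `G t s σ`, the iterated Cauchy operation of `G t` at fixed `(s, σ)` is continuous in the
t_□-variable `t` (leaf-08-g4's `continuous_cauchyOp` with the parameter `t`). [folklore] -/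
theorem continuous_cauchyOp_param {ρ : ℝ} (hρ : 1 < ρ) (l : List ι) {G : ℂ → (ι → ℝ) → (ι → ℂ) → F}
    (hG : Continuous fun p : ℂ × (ι → ℝ) × (ι → ℂ) => G p.1 p.2.1 p.2.2) (s : ι → ℝ) (σ : ι → ℂ) :
    Continuous fun t : ℂ => cauchyOp ρ l (G t) s σ := by
  have e : Continuous fun t : ℂ => (t, (s, σ)) :=
    continuous_id.prodMk (continuous_const : Continuous fun _ : ℂ => (s, σ))
  exact (continuous_cauchyOp (X := ℂ) hρ l (h := G) hG).comp e

/-- The t_□-integrand `t ↦ (t²)⁻¹ • cauchyOp ρ l (G t) s σ` of (1.23) is circle-integrable on `|t| = r`, `r > 0` (continuous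
there: `t² ≠ 0` on the circle). [cite: Balaban1988RG2Cluster, (1.22)-(1.23) p.7] -/
theorem circleIntegrable_contourIntegrand {ρ r : ℝ} (hρ : 1 < ρ) (hr : 0 < r) (l : List ι)
    {G : ℂ → (ι → ℝ) → (ι → ℂ) → F} (hG : Continuous fun p : ℂ × (ι → ℝ) × (ι → ℂ) => G p.1 p.2.1 p.2.2)
    (s : ι → ℝ) (σ : ι → ℂ) :
    CircleIntegrable (fun t => (t ^ 2)⁻¹ • cauchyOp ρ l (G t) s σ) 0 r := by
  refine ContinuousOn.circleIntegrable hr.le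
    (ContinuousOn.smul ?_ (continuous_cauchyOp_param hρ l hG s σ).continuousOn)
  refine ContinuousOn.inv₀ (by fun_prop) fun t ht => pow_ne_zero _ ?_
  intro h0
  have htn : ‖t‖ = r := by simpa using ht
  rw [h0, norm_zero] at htn
  exact hr.ne' htn.symm

/-- **THE (1.23) CONTOUR FUNCTIONAL IS SUBTRACTIVE ON JOINTLY CONTINUOUS INTEGRAND FAMILIES**: for `ρ > 1`, `r > 0` and
`G₁, G₂ : ℂ → (ι → ℝ) → (ι → ℂ) → F` jointly continuous,
`(2πi)⁻¹ ∮_{|t|=r} t⁻²·cauchyOp ρ l (G₁ t − G₂ t) s σ = (2πi)⁻¹ ∮ t⁻²·cauchyOp ρ l (G₁ t) s σ − (2πi)⁻¹ ∮ t⁻²·cauchyOp ρ l (G₂ t) s σ`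
(the iterated Cauchy operation is subtractive under continuity — `cauchyOp_sub` — and the t_□-circle integral under
circle-integrability; WITHOUT the continuity binders neither Bochner integral is additive).  The common core of leaf-08-g4's
`remPiece_sub` / `curPiece_sub`, stated for an arbitrary integrand family. [cite: Balaban1988RG2Cluster, (1.10) p.4, (1.23) p.7] -/
theorem contourOp_sub {ρ r : ℝ} (hρ : 1 < ρ) (hr : 0 < r) (l : List ι) {G₁ G₂ : ℂ → (ι → ℝ) → (ι → ℂ) → F}
    (hG₁ : Continuous fun p : ℂ × (ι → ℝ) × (ι → ℂ) => G₁ p.1 p.2.1 p.2.2)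
    (hG₂ : Continuous fun p : ℂ × (ι → ℝ) × (ι → ℂ) => G₂ p.1 p.2.1 p.2.2) (s : ι → ℝ) (σ : ι → ℂ) :
    (2 * Real.pi * I : ℂ)⁻¹ • (∮ t in C(0, r), (t ^ 2)⁻¹ • cauchyOp ρ l (G₁ t - G₂ t) s σ) =
      (2 * Real.pi * I : ℂ)⁻¹ • (∮ t in C(0, r), (t ^ 2)⁻¹ • cauchyOp ρ l (G₁ t) s σ) -
        (2 * Real.pi * I : ℂ)⁻¹ • (∮ t in C(0, r), (t ^ 2)⁻¹ • cauchyOp ρ l (G₂ t) s σ) := by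
  have hpt : ∀ t : ℂ, cauchyOp ρ l (G₁ t - G₂ t) s σ = cauchyOp ρ l (G₁ t) s σ - cauchyOp ρ l (G₂ t) s σ := by
    intro t
    have e : Continuous fun q : (ι → ℝ) × (ι → ℂ) => (t, q) :=
      (continuous_const : Continuous fun _ : (ι → ℝ) × (ι → ℂ) => t).prodMk continuous_id
    exact cauchyOp_sub hρ l (hG₁.comp e) (hG₂.comp e) s σ
  simp_rw [hpt, smul_sub]
  rw [circleIntegral.integral_sub (circleIntegrable_contourIntegrand hρ hr l hG₁ s σ)
    (circleIntegrable_contourIntegrand hρ hr l hG₂ s σ), smul_sub]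

end Contour

/-! ## §2 The kernel species: `PieceAdditiveOn (analyticClass K.R) K.toC` and the four S-binders -/

section Species

variable {C : Carriers} {E : Type} [NormedAddCommGroup E] [NormedSpace ℂ E] {ι α β γ δ Pt : Type} [DecidableEq δ]

omit [NormedAddCommGroup E] [NormedSpace ℂ E] in
/-- The kernel species' piece, definitionally: Re/Im of the (1.23) contour functional of the double point sum read on the
complex old term `lift H X` (the owner's `KerData.toC`, with the integrand family written `t ↦ K.dsum … (lift H X) t`). [folklore] -/
theorem toC_piece_eq (K : KerData C E ι α β γ δ Pt) (k : ℕ) (s : ℕ → ℝ) (y : ι) (a : α) (b : β)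
    (x : (doubleCarriers C).Dom) (H : E → (doubleCarriers C).Dom → ℝ) :
    K.toC.piece k s y a b x H = reIm x.2 ((2 * Real.pi * I : ℂ)⁻¹ • ∮ t in C(0, K.r k), (t ^ 2)⁻¹ •
      cauchyOp (Real.exp K.κ₁) (K.cubes k y a b) (K.dsum k s y a b x (lift H x.1) t)
        (fun _ => (0:ℝ)) (fun _ => ((Real.exp K.κ₁ : ℝ) : ℂ))) := rfl

omit [NormedAddCommGroup E] [NormedSpace ℂ E] [DecidableEq δ] in
/-- The double point sum is SUBTRACTIVE in the old term whenever every summand of the point family is (at the given contour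
point). [folklore] -/
theorem dsum_sub (K : KerData C E ι α β γ δ Pt) {k : ℕ} {s : ℕ → ℝ} {y : ι} {a : α} {b : β}
    {x : (doubleCarriers C).Dom} {t : ℂ} {s' : δ → ℝ} {σ' : δ → ℂ} {F₁ F₂ : E → ℂ}
    (h : ∀ p ∈ K.pts k y a, ∀ q ∈ K.pts k y a,
      K.ker k s y a b x t s' σ' p q (F₁ - F₂) = K.ker k s y a b x t s' σ' p q F₁ - K.ker k s y a b x t s' σ' p q F₂) :
    K.dsum k s y a b x (F₁ - F₂) t s' σ' = K.dsum k s y a b x F₁ t s' σ' - K.dsum k s y a b x F₂ t s' σ' := by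
  unfold KerData.dsum
  rw [← Finset.sum_sub_distrib]
  refine Finset.sum_congr rfl fun p hp => ?_
  rw [← Finset.sum_sub_distrib]
  exact Finset.sum_congr rfl fun q hq => h p hp q hq

omit [NormedAddCommGroup E] [NormedSpace ℂ E] [DecidableEq δ] in
/-- The double point sum is jointly continuous in the contour variables `(t, s′, σ′)` whenever every summand of the point family
is (finite sums). [folklore] -/
theorem continuous_dsum (K : KerData C E ι α β γ δ Pt) {k : ℕ} {s : ℕ → ℝ} {y : ι} {a : α} {b : β}
    {x : (doubleCarriers C).Dom} {F : E → ℂ}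
    (h : ∀ p ∈ K.pts k y a, ∀ q ∈ K.pts k y a,
      Continuous fun w : ℂ × (δ → ℝ) × (δ → ℂ) => K.ker k s y a b x w.1 w.2.1 w.2.2 p q F) :
    Continuous fun w : ℂ × (δ → ℝ) × (δ → ℂ) => K.dsum k s y a b x F w.1 w.2.1 w.2.2 := by
  unfold KerData.dsum
  exact continuous_finsetSum _ fun p hp => continuous_finsetSum _ fun q hq => h p hp q hq

/-- **`PieceAdditiveOn` FOR THE KERNEL SPECIES ON THE ANALYTIC CLASS (crew row (w23); the point of the module)**: S3's
piece-level binder `PieceAdditiveOn (analyticClass K.R) K.toC` — the (1.23)-pieces of the point-localized double sums are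
SUBTRACTIVE in the old term on the analytic class — under `κ₁ > 0` (σ-circles of radius e^{κ₁} > 1), `r_k > 0`, and the two
SUMMAND-REGULARITY binders (displayed, instantiation-side — TYPE [I] (4.21) p. 285 / (4.22) p. 286: the point-localized kernels
are multilinear in the derivatives of the old term and continuous in the contour point): **(A) `hkerA`** — on old terms analytic
on the ball of radius `R_X` the summand at every pair of points of the family is subtractive, `ker … p q (F₁ − F₂) = ker … p q F₁ −
ker … p q F₂`; **(C) `hkerC`** — for such an old term the summand is jointly continuous in `(t, s′, σ′)` (a harmless convention off
the contours: the functional reads it on the contours only).  Proof: `lift` is subtractive, the double sum is subtractive (A) and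
continuous (C), and §1's `contourOp_sub`. [cite: Balaban1987RG1, (4.21) p.285, (4.22) p.286; Balaban1988RG2Cluster, (1.23) p.7] -/
theorem pieceAdditiveOn_ker (K : KerData C E ι α β γ δ Pt) (hκ₁ : 0 < K.κ₁) (hr : ∀ k, 0 < K.r k)
    (hkerA : ∀ (k : ℕ) (s : ℕ → ℝ) (y : ι) (a : α) (b : β) (x : (doubleCarriers C).Dom) (t : ℂ) (s' : δ → ℝ)
      (σ' : δ → ℂ), ∀ p ∈ K.pts k y a, ∀ q ∈ K.pts k y a, ∀ F₁ F₂ : E → ℂ,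
        DifferentiableOn ℂ F₁ (ball 0 (K.R x.1)) → DifferentiableOn ℂ F₂ (ball 0 (K.R x.1)) →
          K.ker k s y a b x t s' σ' p q (F₁ - F₂) = K.ker k s y a b x t s' σ' p q F₁ - K.ker k s y a b x t s' σ' p q F₂)
    (hkerC : ∀ (k : ℕ) (s : ℕ → ℝ) (y : ι) (a : α) (b : β) (x : (doubleCarriers C).Dom),
      ∀ p ∈ K.pts k y a, ∀ q ∈ K.pts k y a, ∀ F : E → ℂ, DifferentiableOn ℂ F (ball 0 (K.R x.1)) →
        Continuous fun w : ℂ × (δ → ℝ) × (δ → ℂ) => K.ker k s y a b x w.1 w.2.1 w.2.2 p q F) :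
    PieceAdditiveOn (analyticClass K.R) K.toC := by
  intro k s y a b x H₁ h₁ H₂ h₂
  rw [toC_piece_eq, toC_piece_eq, toC_piece_eq, ← reIm_sub]
  congr 1
  -- the integrand family of the difference IS the difference of the integrand families (lift subtractive, (A))
  have hd : K.dsum k s y a b x (lift (H₁ - H₂) x.1) =
      fun t => K.dsum k s y a b x (lift H₁ x.1) t - K.dsum k s y a b x (lift H₂ x.1) t := by
    funext t s' σ'
    rw [lift_sub, Pi.sub_apply, Pi.sub_apply]
    exact dsum_sub K fun p hp q hq => hkerA k s y a b x t s' σ' p hp q hq _ _ (h₁ x.1) (h₂ x.1)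
  rw [hd]
  -- both integrand families are jointly continuous (C); §1
  exact contourOp_sub (one_lt_exp_of_pos hκ₁) (hr k) (K.cubes k y a b)
    (continuous_dsum K fun p hp q hq => hkerC k s y a b x p hp q hq _ (h₁ x.1))
    (continuous_dsum K fun p hp q hq => hkerC k s y a b x p hp q hq _ (h₂ x.1)) _ _

/-- **S3 FOR THE KERNEL SPECIES**: `ChannelAdditive (analyticClass K.R) (cpieceChannel K.toC)` — the owner's
`channelAdditive_ker_of_pieceAdditive` fed with `pieceAdditiveOn_ker`. [folklore] -/
theorem channelAdditive_ker (K : KerData C E ι α β γ δ Pt) (hκ₁ : 0 < K.κ₁) (hr : ∀ k, 0 < K.r k)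
    (hkerA : ∀ (k : ℕ) (s : ℕ → ℝ) (y : ι) (a : α) (b : β) (x : (doubleCarriers C).Dom) (t : ℂ) (s' : δ → ℝ)
      (σ' : δ → ℂ), ∀ p ∈ K.pts k y a, ∀ q ∈ K.pts k y a, ∀ F₁ F₂ : E → ℂ,
        DifferentiableOn ℂ F₁ (ball 0 (K.R x.1)) → DifferentiableOn ℂ F₂ (ball 0 (K.R x.1)) →
          K.ker k s y a b x t s' σ' p q (F₁ - F₂) = K.ker k s y a b x t s' σ' p q F₁ - K.ker k s y a b x t s' σ' p q F₂)
    (hkerC : ∀ (k : ℕ) (s : ℕ → ℝ) (y : ι) (a : α) (b : β) (x : (doubleCarriers C).Dom),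
      ∀ p ∈ K.pts k y a, ∀ q ∈ K.pts k y a, ∀ F : E → ℂ, DifferentiableOn ℂ F (ball 0 (K.R x.1)) →
        Continuous fun w : ℂ × (δ → ℝ) × (δ → ℂ) => K.ker k s y a b x w.1 w.2.1 w.2.2 p q F) :
    ChannelAdditive (analyticClass K.R) (cpieceChannel K.toC) :=
  channelAdditive_ker_of_pieceAdditive (pieceAdditiveOn_ker K hκ₁ hr hkerA hkerC)

/-- **ALL FOUR S-BINDERS OF THE NE9 END FOR THE KERNEL SPECIES ON THE ANALYTIC CLASS** (S3 `ChannelAdditive` — this file; S4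
`ChannelLocal` / `ChannelStepSum` and S5 `ChannelSizeAtStepNN` at the TWO-RATE weight `weightOf K.toC.frame κ₁ d₀ O1 (K.Kp cK w₀
c₀ c₁)` with level counts at the OUTPUT rate `κ − w` — the owner's `structureBinders_ker` / `channelSizeAtStepNN_ker` BY NAME):
under `KerData.Admissible` ((K)/(G)/(S) and the printed-TYPE bookkeeping, displayed), the level counts, and the summand-regularity
binders (A)/(C) of `pieceAdditiveOn_ker` — i.e. KERNEL modulo O1, printed-TYPE binders and summand regularity.
[cite: Balaban1987RG1, (4.22) p.286; Balaban1988RG2Cluster, (1.23)-(1.29) pp.7-8] -/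
theorem sBinders_ker {K : KerData C E ι α β γ δ Pt} {ℓ ℓ' gain : ℕ → ℕ → ℝ} {cK δ₀ δ₁ w w0 c0 c1 d0 O1 cQ : ℝ}
    (hK : K.Admissible ℓ gain cK δ₀ δ₁ w w0 c0 c1 d0) (κ : ℝ)
    (hL : LevelCountsG K.toC.frame (κ - w) K.κ₁ O1 cQ gain ℓ') (hO1 : 0 ≤ O1) (hcQℓ : ∀ k j, 0 ≤ cQ * ℓ' k j)
    (hkerA : ∀ (k : ℕ) (s : ℕ → ℝ) (y : ι) (a : α) (b : β) (x : (doubleCarriers C).Dom) (t : ℂ) (s' : δ → ℝ)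
      (σ' : δ → ℂ), ∀ p ∈ K.pts k y a, ∀ q ∈ K.pts k y a, ∀ F₁ F₂ : E → ℂ,
        DifferentiableOn ℂ F₁ (ball 0 (K.R x.1)) → DifferentiableOn ℂ F₂ (ball 0 (K.R x.1)) →
          K.ker k s y a b x t s' σ' p q (F₁ - F₂) = K.ker k s y a b x t s' σ' p q F₁ - K.ker k s y a b x t s' σ' p q F₂)
    (hkerC : ∀ (k : ℕ) (s : ℕ → ℝ) (y : ι) (a : α) (b : β) (x : (doubleCarriers C).Dom),
      ∀ p ∈ K.pts k y a, ∀ q ∈ K.pts k y a, ∀ F : E → ℂ, DifferentiableOn ℂ F (ball 0 (K.R x.1)) →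
        Continuous fun w : ℂ × (δ → ℝ) × (δ → ℂ) => K.ker k s y a b x w.1 w.2.1 w.2.2 p q F) :
    ChannelAdditive (analyticClass K.R) (cpieceChannel K.toC) ∧
      ChannelLocal (analyticClass K.R) (cpieceChannel K.toC) ∧
      ChannelStepSum (analyticClass K.R) (cpieceChannel K.toC) ∧
      ChannelSizeAtStepNN (analyticClass K.R) (cpieceChannel K.toC) κ
        (weightOf K.toC.frame K.κ₁ d0 O1 (K.Kp cK w0 c0 c1)) (tauOfG cQ ℓ') :=
  have hκ₁ : 0 < K.κ₁ := lt_of_lt_of_le one_pos hK.κ₁_ge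
  ⟨channelAdditive_ker K hκ₁ hK.r_pos hkerA hkerC, (structureBinders_ker hK _).1, (structureBinders_ker hK _).2.1,
    channelSizeAtStepNN_ker hK κ hL hO1 hcQℓ⟩

end Species

end Summit.QuantumFields.BalabanUV.T4Continuum.NE9Lemma1KernelSpeciesAdditive

end
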